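import Summits.Ventures.Crystal3D.TopCut.CapD12u59Agg1

/-!
# Cap cut `CapD12u59` (u₀ = -59/100, degree 12): kernel validation of Gram blocks E0 (chunk theorems okE0_1, okE0_2, okE0_3, okE0_4; cost proxy 0.45 Gbit)

HONEST FRAMING: generated data / kernel-validation file of the venture `Crystal3D` (cell `pub-crystal3d`, phase 2,
seat p2): one piece of the kernel replay of an EXACT Bachoc–Vallentin CAP certificate on `S²` ([BachocVallentin2009]
Theorem 4.4, n = 3; cap level u₀ = -59/100, inner products ≤ 1/2, degree d = 12) solved directly in sum-of-squares form
(`capfull.py`: CLARABEL float solve → exact rounding → integer identities; certificate `d12_u59over100`, bound value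
11.985342 < 12) and checked through `TopCut/CapSOSCheck.lean` + `CapSOSSound.lean` (generic checker + soundness) and the tree's
`ThreePointCert.CheckKron` (Kronecker-packed Gram chunk validation). Nothing geometric is proved in this file; plain lists of
integers / rationals / monomials and `decide +kernel` facts about them (standard axioms only, no `native_decide`).
-/

namespace Summit.Ventures.Crystal3D.TopCut.CapD12u59

open Literature.Geometry.DiscreteGeometry Literature.Geometry.DiscreteGeometry.PolyCert PolyCert.SPoly
open Literature.Geometry.DiscreteGeometry.BachocVallentin
open Summit.Ventures.PackingBounds.ThreePointCert Summit.Ventures.Crystal3D.CapSOS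

set_option maxRecDepth 100000 in
set_option maxHeartbeats 0 in
/-- Block `E0`: rows from 0 (63 rows) of `zᵀ(LLᵀ)z` added to `[]` give `dE0c1` (kernel, Kronecker-packed chunk check). [folklore] -/
theorem okE0_1 : chunkOKK CapD12u59.gE0K 0 63 [] CapD12u59.dE0c1 = true := by
  decide +kernel

set_option maxRecDepth 100000 in
set_option maxHeartbeats 0 in
/-- Block `E0`: rows from 63 (42 rows) of `zᵀ(LLᵀ)z` added to `dE0c1` give `dE0c2` (kernel, Kronecker-packed chunk check). [folklore] -/
theorem okE0_2 : chunkOKK CapD12u59.gE0K 63 42 CapD12u59.dE0c1 CapD12u59.dE0c2 = true := by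
  decide +kernel

set_option maxRecDepth 100000 in
set_option maxHeartbeats 0 in
/-- Block `E0`: rows from 105 (33 rows) of `zᵀ(LLᵀ)z` added to `dE0c2` give `dE0c3` (kernel, Kronecker-packed chunk check). [folklore] -/
theorem okE0_3 : chunkOKK CapD12u59.gE0K 105 33 CapD12u59.dE0c2 CapD12u59.dE0c3 = true := by
  decide +kernel

set_option maxRecDepth 100000 in
set_option maxHeartbeats 0 in
/-- Block `E0`: rows from 138 ((CapD12u59.gE0K.z.length - 138) rows) of `zᵀ(LLᵀ)z` added to `dE0c3` give `eE0` (kernel, Kronecker-packed chunk check). [folklore] -/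
theorem okE0_4 : chunkOKK CapD12u59.gE0K 138 (CapD12u59.gE0K.z.length - 138) CapD12u59.dE0c3 CapD12u59.eE0 = true := by
  decide +kernel

end Summit.Ventures.Crystal3D.TopCut.CapD12u59
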